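import Mathlib
import Summits.Ventures.HodgeRepro.Tier4.Common.AdelicDefs
import Summits.Ventures.HodgeRepro.Tier4.Common.CompactOpenLevel
import Summits.Ventures.HodgeRepro.Tier4.Common.LevelBasis
import Summits.Ventures.HodgeRepro.Tier4.Line1.RTFSetting
import Summits.Ventures.HodgeRepro.Tier4.Line1.RealisedSetting
import Summits.Ventures.HodgeRepro.Tier4.Line1.IsolatingTestsLevel

/-!
# Tier4/Line1/IsolatingTestsDeepLevel — F2′ AT EVERY DEEP LEVEL: the isolating test pair of J2 with `f₁` bi-invariant
under the principal congruence subgroup `K(N)` for EVERY level `N` deeper than one `N₀` (the tower over the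
divisibility order), and the DEFINED block of the residual at such a level

Blind re-derivation cell `pub-hodge-repro`, Tier 4 (README §9–§10), seat t4-L1-p4 (gen 4); self-named cut S13732,
reshaped S13754 after t4-L1-p3 g2's S13748 and t4-plan-1 g2's v0.38 (S13780): this module imports nothing of p3's
beyond IsolatingTestsLevel and nothing of the skeleton, so it waits on neither.  Target tree
path `lean/Summits/Ventures/HodgeRepro/Tier4/Line1/IsolatingTestsDeepLevel.lean`.

WHAT THIS IS.  t4-L1-p3 g2's IsolatingTestsLevel (p680263, `exists_isolating_tests_level`) gives F2′ in its tower
shape: a neighbourhood `V` of `1` in `U(W)(𝔸_k)` such that EVERY compact subgroup `K ⊆ V` admits an isolating pair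
`f₁ ⋆ f₂` with `f₁` bi-`K`-invariant; the consumer's input — «a compact open `K ≤ G(𝔸_f)` inside `V`» — was t4-plan-1's
WANTED-COMMON S13521 (2), answered by t4-typer-2 g2's CompactOpenLevel (p683144: `levelK W N` compact, open in the finite
part, `N ≠ 0`) and LevelBasis (p683691: `exists_levelK_subset_nhds_one`).  Here: `K(N) ≤ K(M)` whenever `M ∣ N`
(`levelK_antitone`, from `IsCongr.of_dvd`), so every neighbourhood of `1` contains EVERY deep enough `K(N)`
(`exists_levelK_subset_nhds_one_deep`: one `N₀ ≠ 0` with `K(N) ⊆ V` for all multiples `N` of `N₀`), and the isolating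
pair exists with `f₁` bi-`K(N)`-invariant for EVERY non-zero multiple `N` of `N₀` (`exists_isolating_tests_deepLevel` —
the «deep level» of the skeleton's J2 docstring as a kernel statement over the tower of levels); the skeleton's consumer
`defined_inputs_realisable_levelK` (v0.38: the DEFINED block of `Inputs'` with the adapted ONB and `f₁`
bi-`K(N)`-invariant for SOME `N ≠ 0`) is re-stated in tower form (`defined_inputs_realisable_deepLevel`: for EVERY
non-zero multiple `N` of one `N₀`).  The single-level statement `exists_isolating_tests_levelK` and the level of the
hit constituent are t4-L1-p3 g2's (IsolatingTestsLevelK, S13748), not restated here.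

WHAT THIS IS NOT (CENSUS v14 §D, t4-L1-p1 S13625).  `K(N)` is open in the FINITE part only, not in `U(W)(𝔸_k)`; the
(S1b) theorems of HeckeFiniteness (p680820) and HeckeFinitenessType (p682171) ask an OPEN subgroup of the full adelic
group (`K_f × U(W)(ℝ)`), i.e. a `K_∞`-finite archimedean component of `f₁`, while F2′'s `f₁` carries an archimedean BUMP.
Nothing here bridges the two: the archimedean refinement of F2′ stays the census' missing bridge, and the weight of (P)
stays in (S1a) / (S3′).  No printed input is consumed; the theorems say nothing about WHICH `N₀`.
Nothing here says anything about the status of the Hodge conjecture for CM abelian varieties, which is NOT proved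
(HC_CM is NOT proved by anyone in this repository).
-/

set_option autoImplicit false

noncomputable section

namespace Summit.Ventures.HodgeRepro.Tier4.Line1

open NumberField Common MeasureTheory Topology

section Level

variable {k : Type} [Field k] [NumberField k] (W : PlaneData k)

/-- **Deeper level, smaller subgroup**: `K(N) ≤ K(M)` whenever `M ∣ N` (both congruence conditions descend along
divisibility, `IsCongr.of_dvd`). -/
theorem levelK_antitone {M N : ℕ} (h : M ∣ N) : levelK W N ≤ levelK W M := by
  intro g hg
  rw [mem_levelK] at hg ⊢
  exact ⟨hg.1.of_dvd h, hg.2.of_dvd h⟩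

/-- **Every neighbourhood of `1` contains every deep enough `K(N)`**: there is `N₀ ≠ 0` with `K(N) ⊆ V` for all
multiples `N` of `N₀` (the tower form of `exists_levelK_subset_nhds_one`). -/
theorem exists_levelK_subset_nhds_one_deep {V : Set (GA W)} (hV : V ∈ 𝓝 (1 : GA W)) :
    ∃ N₀ : ℕ, N₀ ≠ 0 ∧ ∀ N : ℕ, N₀ ∣ N → (levelK W N : Set (GA W)) ⊆ V := by
  obtain ⟨N₀, hN₀, hsub⟩ := exists_levelK_subset_nhds_one W hV
  exact ⟨N₀, hN₀, fun N hdvd => (SetLike.coe_subset_coe.2 (levelK_antitone W hdvd)).trans hsub⟩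

end Level

section Instance

variable {k : Type} [Field k] [NumberField k] (W : PlaneData k) [MeasurableSpace (GA W)] [BorelSpace (GA W)]
  (hW : IsDefinite W) (hg : IsGenuineRow W) (R : RTFData W) (μ : Measure (GA W)) [μ.IsHaarMeasure]
  [R.μT.IsHaarMeasure] [R.μT'.IsHaarMeasure] (hT : IsCompact (closure R.DT)) (hT' : IsCompact (closure R.DT'))

/-- **F2′ at every deep level**: for the defined tori and characters (continuous, unitary, N2) there is `N₀ ≠ 0` such
that for EVERY non-zero multiple `N` of `N₀` there are test functions `f₁`, `f₂` with `f₁ ⋆ f₂` meeting exactly one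
rational double coset `o₀` on `DT × DT′`, a non-zero orbital term, and `f₁` bi-invariant under the principal congruence
subgroup `K(N)` of `G(𝔸_f)` — `exists_isolating_tests_level` at `K := levelK W N ⊆ K(N₀) ⊆ V`
(`exists_levelK_subset_nhds_one_deep`), compact by `isCompact_levelK`. -/
theorem exists_isolating_tests_deepLevel (hc : Continuous R.chi) (hu : ∀ a, ‖R.chi a‖ = 1)
    (hc' : Continuous R.chi') (hu' : ∀ a, ‖R.chi' a‖ = 1) :
    ∃ N₀ : ℕ, N₀ ≠ 0 ∧ ∀ N : ℕ, N ≠ 0 → N₀ ∣ N →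
      ∃ (f₁ f₂ : GA W → ℂ) (o₀ : (Setting.ofAdelic W hW hg R μ hT hT').Orbit),
        RTF.IsTest f₁ ∧ RTF.IsTest f₂ ∧ RTF.IsTest ((Setting.ofAdelic W hW hg R μ hT hT').conv f₁ f₂) ∧
        (Setting.ofAdelic W hW hg R μ hT hT').geoSupport ((Setting.ofAdelic W hW hg R μ hT hT').conv f₁ f₂) = {o₀} ∧
        (Setting.ofAdelic W hW hg R μ hT hT').orbital R.chi R.chi' o₀
          ((Setting.ofAdelic W hW hg R μ hT hT').conv f₁ f₂) ≠ 0 ∧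
        ∀ k ∈ levelK W N, ∀ x, f₁ (x * k) = f₁ x ∧ f₁ (k * x) = f₁ x := by
  obtain ⟨V, hVn, hV⟩ := exists_isolating_tests_level W hW hg R μ hT hT' hc hu hc' hu'
  obtain ⟨N₀, hN₀, hsub⟩ := exists_levelK_subset_nhds_one_deep W hVn
  exact ⟨N₀, hN₀, fun N hN hdvd => hV (levelK W N) (isCompact_levelK W hN) (hsub N hdvd)⟩

/-- **The DEFINED block of the residual at every deep level** (the skeleton's `defined_inputs_realisable_levelK`, v0.38,
in tower form): an adapted ONB `(τ, φ, n)` and, for EVERY non-zero multiple `N` of one `N₀ ≠ 0`, an isolating pair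
`(f₁, f₂, o₀)` with `f₁` bi-`K(N)`-invariant — the level of the defined block may be taken as deep as any consumer
needs (the `K := ⊥` degenerate reading is retired at every level at once). -/
theorem defined_inputs_realisable_deepLevel (hc : Continuous R.chi) (hu : ∀ a, ‖R.chi a‖ = 1)
    (hc' : Continuous R.chi') (hu' : ∀ a, ‖R.chi' a‖ = 1) :
    ∃ (τ : ℕ → Set (GA W → ℂ)) (φ : ℕ → GA W → ℂ) (n : ℕ → ℕ),
      (Setting.ofAdelic W hW hg R μ hT hT').IsAdaptedONB τ φ n ∧
      ∃ N₀ : ℕ, N₀ ≠ 0 ∧ ∀ N : ℕ, N ≠ 0 → N₀ ∣ N →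
        ∃ (f₁ f₂ : GA W → ℂ) (o₀ : (Setting.ofAdelic W hW hg R μ hT hT').Orbit),
          RTF.IsTest f₁ ∧ RTF.IsTest f₂ ∧ RTF.IsTest ((Setting.ofAdelic W hW hg R μ hT hT').conv f₁ f₂) ∧
          (Setting.ofAdelic W hW hg R μ hT hT').geoSupport ((Setting.ofAdelic W hW hg R μ hT hT').conv f₁ f₂) = {o₀} ∧
          (Setting.ofAdelic W hW hg R μ hT hT').orbital R.chi R.chi' o₀
            ((Setting.ofAdelic W hW hg R μ hT hT').conv f₁ f₂) ≠ 0 ∧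
          ∀ k ∈ levelK W N, ∀ x, f₁ (x * k) = f₁ x ∧ f₁ (k * x) = f₁ x := by
  obtain ⟨τ, φ, n, hB⟩ := exists_adaptedONB W hW hg R μ hT hT'
  exact ⟨τ, φ, n, hB, exists_isolating_tests_deepLevel W hW hg R μ hT hT' hc hu hc' hu'⟩

end Instance

end Summit.Ventures.HodgeRepro.Tier4.Line1

end
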